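import Mathlib
import HarnessLib
import Summits.ValiantsHypothesis.ValiantsHypothesis.Theorems.LacunarySymmetroidMatrixDescartesProductPlusOnePosCoeff

/-!
# ValiantsHypothesis / LacunarySymmetroid — crux `MatrixDescartes` (stmt-ValiantsHypothesis-18050, V1),
# LINE (A) «product_plus_one», research stub `stub_classRowK3`: the TAME SECTOR of the `K = 3` row — CALCULUS

Setting of the `K = 3` row (`Cruxes/MatrixDescartes/Lines/product_plus_one.lean` @a0cf3f5276f3, `ClassRowK3Linear`): members
`c·x^{m d₀} + ∏_{j<m} (a_j x^{d₀} + b_j x^{d₁} + c_j x^{d₂})`; on `(0,∞)` and after division by `x^{m d₀}` (coupled letter = the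
bottom exponent): `κ + ∏_j g_j(x)`, `g_j(x) = a_j + b_j x^p + c_j x^q`, `p = d₁ − d₀ = e + 1`, `q = d₂ − d₀ = e + k + 2`.

THE TAME SECTOR: every factor has extreme coefficients of OPPOSITE signs (`a_j c_j < 0`) and the support ratio satisfies
`q ≤ 4p` (`k ≤ 3e + 2`).  There (this file) the logarithmic derivative of the product, normalised as
`Ψ(x) = Σ_j (p b_j + q c_j x^{q−p}) / g_j(x)` (`(∏ g_j)′(x) = (∏ g_j)(x) · x^{p−1} · Ψ(x)` off the zeros), is STRICTLY DECREASING on every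
interval free of zeros of the factors: `Ψ′ = Σ_j N_j / g_j²` with
`N_j(x) = a_j c_j q(q−p) x^{q−p−1} + x^{p−1}·(q(q−3p) b_j c_j x^{q−p} − pq c_j² x^{2(q−p)} − p² b_j²) < 0`, because
`4p·(pq c² Z² − q(q−3p) bc Z + p² b²) = q (2pcZ − (q−3p)b)² + (q−p)²(4p−q) b²` (`key_identity`; the threshold `q ≤ 4p` is sharp for
this certificate: `r(r−3)² − 4 = (r−1)²(r−4)`).  Consequences drawn in `…ProductPlusOneTameSector.lean`: each factor has ≤ 1 positive
zero, Rolle twice, at most two zeros of a member per gap, `Z₊ ≤ 2m + 2` — LINEAR in `m`, uniformly in the (lacunary) support, where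
Descartes gives `C(m+2,2) − 1`.

HONEST FRAMING: a sector/sub-row of the research stub, NOT `stub_classRowK3` (all signs, all supports), not `stub_polyLaw`, not
`ProductPlusOneMDR`, not `MatrixDescartes`, not Conjecture B; `VP ≠ VNP` is NOT proved.  No definitions, no named facts; Mathlib +
the lane's Descartes file.
-/

-- `Summit.ValiantsHypothesis.ValiantsHypothesis.…` is the tree's mandated single-conjunct layout (Sub = Summit).
set_option linter.dupNamespace false

namespace Summit.ValiantsHypothesis.ValiantsHypothesis.Theorems.LacunarySymmetroidMatrixDescartes

namespace ProductPlusOne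

open Polynomial Finset
open scoped BigOperators

/-! ### The key inequality -/

/-- `4p·(pq c² Z² − q(q−3p) bc Z + p² b²) = q (2pcZ − (q−3p) b)² + (q−p)² (4p−q) b²`. [folklore] -/
theorem key_identity (p q b c Z : ℝ) :
    4 * p * (p * q * c ^ 2 * Z ^ 2 - q * (q - 3 * p) * b * c * Z + p ^ 2 * b ^ 2)
      = q * (2 * p * c * Z - (q - 3 * p) * b) ^ 2 + (q - p) ^ 2 * (4 * p - q) * b ^ 2 := by
  ring

/-- For `0 < p`, `0 ≤ q ≤ 4p` and all real `b, c, Z`: `q(q−3p) bc Z − pq c² Z² − p² b² ≤ 0`. [folklore] -/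
theorem key_quadratic_nonpos {p q : ℝ} (hp : 0 < p) (hq : 0 ≤ q) (hq4 : q ≤ 4 * p) (b c Z : ℝ) :
    q * (q - 3 * p) * b * c * Z - p * q * c ^ 2 * Z ^ 2 - p ^ 2 * b ^ 2 ≤ 0 := by
  have h := key_identity p q b c Z
  have h1 : 0 ≤ q * (2 * p * c * Z - (q - 3 * p) * b) ^ 2 := mul_nonneg hq (sq_nonneg _)
  have h2 : 0 ≤ (q - p) ^ 2 * (4 * p - q) * b ^ 2 :=
    mul_nonneg (mul_nonneg (sq_nonneg _) (by linarith)) (sq_nonneg _)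
  nlinarith

/-- **The numerator of `Ψ_j′` is negative** in the tame sector: for `x > 0`, `a c < 0`, `k ≤ 3e + 2`
(`p = e+1`, `q = e+k+2`, `q ≤ 4p`):
`(q c (k+1) x^k)·g(x) − (p b + q c x^{k+1})·g′(x) < 0` with `g(x) = a + b x^p + c x^q`. [this file's lemma] -/
theorem numerator_neg (a b c : ℝ) (e k : ℕ) (hk : k ≤ 3 * e + 2) (hac : a * c < 0) {x : ℝ} (hx : 0 < x) :
    ((e + k + 2 : ℝ) * c * ((k + 1 : ℝ) * x ^ k)) * (a + b * x ^ (e + 1) + c * x ^ (e + k + 2))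
      - ((e + 1 : ℝ) * b + (e + k + 2 : ℝ) * c * x ^ (k + 1))
        * (b * ((e + 1 : ℝ) * x ^ e) + c * ((e + k + 2 : ℝ) * x ^ (e + k + 1))) < 0 := by
  have hxk : 0 < x ^ k := pow_pos hx k
  have hxe : 0 ≤ x ^ e := (pow_pos hx e).le
  have hQ := key_quadratic_nonpos (p := (e + 1 : ℝ)) (q := (e + k + 2 : ℝ)) (by positivity) (by positivity)
    (by have : (k : ℝ) ≤ 3 * e + 2 := by exact_mod_cast hk
        linarith) b c (x ^ (k + 1))
  have hid : ((e + k + 2 : ℝ) * c * ((k + 1 : ℝ) * x ^ k)) * (a + b * x ^ (e + 1) + c * x ^ (e + k + 2))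
      - ((e + 1 : ℝ) * b + (e + k + 2 : ℝ) * c * x ^ (k + 1))
        * (b * ((e + 1 : ℝ) * x ^ e) + c * ((e + k + 2 : ℝ) * x ^ (e + k + 1)))
      = a * c * ((e + k + 2 : ℝ) * (k + 1 : ℝ)) * x ^ k
        + x ^ e * ((e + k + 2 : ℝ) * ((e + k + 2 : ℝ) - 3 * (e + 1 : ℝ)) * b * c * x ^ (k + 1)
          - (e + 1 : ℝ) * (e + k + 2 : ℝ) * c ^ 2 * (x ^ (k + 1)) ^ 2 - (e + 1 : ℝ) ^ 2 * b ^ 2) := by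
    ring
  rw [hid]
  have h1 : a * c * ((e + k + 2 : ℝ) * (k + 1 : ℝ)) * x ^ k < 0 :=
    mul_neg_of_neg_of_pos (mul_neg_of_neg_of_pos hac (by positivity)) hxk
  have h2 : x ^ e * ((e + k + 2 : ℝ) * ((e + k + 2 : ℝ) - 3 * (e + 1 : ℝ)) * b * c * x ^ (k + 1)
          - (e + 1 : ℝ) * (e + k + 2 : ℝ) * c ^ 2 * (x ^ (k + 1)) ^ 2 - (e + 1 : ℝ) ^ 2 * b ^ 2) ≤ 0 :=
    mul_nonpos_of_nonneg_of_nonpos hxe hQ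
  linarith

/-! ### The normalised logarithmic derivative `Ψ` and its derivative -/

/-- `HasDerivAt` of one summand `x ↦ (p b + q c x^{k+1}) / (a + b x^{e+1} + c x^{e+k+2})` off the zeros of the factor.
[folklore] -/
theorem hasDerivAt_term (a b c : ℝ) (e k : ℕ) {x : ℝ} (hg : a + b * x ^ (e + 1) + c * x ^ (e + k + 2) ≠ 0) :
    HasDerivAt (fun y : ℝ => ((e + 1 : ℝ) * b + (e + k + 2 : ℝ) * c * y ^ (k + 1))
        / (a + b * y ^ (e + 1) + c * y ^ (e + k + 2)))
      ((((e + k + 2 : ℝ) * c * ((k + 1 : ℝ) * x ^ k)) * (a + b * x ^ (e + 1) + c * x ^ (e + k + 2))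
        - ((e + 1 : ℝ) * b + (e + k + 2 : ℝ) * c * x ^ (k + 1))
          * (b * ((e + 1 : ℝ) * x ^ e) + c * ((e + k + 2 : ℝ) * x ^ (e + k + 1))))
        / (a + b * x ^ (e + 1) + c * x ^ (e + k + 2)) ^ 2) x := by
  have hnum : HasDerivAt (fun y : ℝ => (e + 1 : ℝ) * b + (e + k + 2 : ℝ) * c * y ^ (k + 1))
      ((e + k + 2 : ℝ) * c * ((k + 1 : ℝ) * x ^ k)) x := by
    have h := ((hasDerivAt_pow (k + 1) x).const_mul ((e + k + 2 : ℝ) * c)).const_add ((e + 1 : ℝ) * b)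
    refine h.congr_deriv ?_
    push_cast
    simp
  have hden : HasDerivAt (fun y : ℝ => a + b * y ^ (e + 1) + c * y ^ (e + k + 2))
      (b * ((e + 1 : ℝ) * x ^ e) + c * ((e + k + 2 : ℝ) * x ^ (e + k + 1))) x := by
    have h1 := ((hasDerivAt_pow (e + 1) x).const_mul b).const_add a
    have h2 := (hasDerivAt_pow (e + k + 2) x).const_mul c
    refine (h1.add h2).congr_deriv ?_
    push_cast
    simp [add_assoc]
  exact hnum.div hden hg

/-- **`Ψ′ < 0`**: on the tame sector, at every `x > 0` where no factor vanishes, `Ψ(x) = Σ_j (p b_j + q c_j x^{k+1})/g_j(x)` has a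
derivative, and it is NEGATIVE (`m ≥ 1`). [this file's theorem] -/
theorem hasDerivAt_psi_neg {m : ℕ} (hm : 0 < m) (a b c : Fin m → ℝ) (e k : ℕ) (hk : k ≤ 3 * e + 2)
    (hac : ∀ j, a j * c j < 0) {x : ℝ} (hx : 0 < x) (hg : ∀ j, a j + b j * x ^ (e + 1) + c j * x ^ (e + k + 2) ≠ 0) :
    ∃ D : ℝ, D < 0 ∧ HasDerivAt (fun y : ℝ => ∑ j, ((e + 1 : ℝ) * b j + (e + k + 2 : ℝ) * c j * y ^ (k + 1))
        / (a j + b j * y ^ (e + 1) + c j * y ^ (e + k + 2))) D x := by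
  refine ⟨∑ j, ((((e + k + 2 : ℝ) * c j * ((k + 1 : ℝ) * x ^ k)) * (a j + b j * x ^ (e + 1) + c j * x ^ (e + k + 2))
        - ((e + 1 : ℝ) * b j + (e + k + 2 : ℝ) * c j * x ^ (k + 1))
          * (b j * ((e + 1 : ℝ) * x ^ e) + c j * ((e + k + 2 : ℝ) * x ^ (e + k + 1))))
        / (a j + b j * x ^ (e + 1) + c j * x ^ (e + k + 2)) ^ 2), ?_, ?_⟩
  · refine Finset.sum_neg (fun j _ => ?_) ⟨⟨0, hm⟩, Finset.mem_univ _⟩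
    exact div_neg_of_neg_of_pos (numerator_neg (a j) (b j) (c j) e k hk (hac j) hx) (by have h0 := hg j; positivity)
  · exact HasDerivAt.fun_sum (u := Finset.univ) (fun j _ => hasDerivAt_term (a j) (b j) (c j) e k (hg j))

end ProductPlusOne

end Summit.ValiantsHypothesis.ValiantsHypothesis.Theorems.LacunarySymmetroidMatrixDescartes
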